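import Mathlib

/-!
# Parabola lift, III: the integer parabola lift (square-difference-free sets of `ℕ` ↦ tangency sets)

Wall-breaker axis *parabola lifts over finite fields*, stub `stub_tangencySets` of the crux
`LevelOneGL2Designs` (stmt-MatrixMultiplication-14080, route `LevelGradedCohnUmans`).

The finite-field parabola lift (`…StubTangencySetsPaleyLift.lean`, Szőnyi 1992) lifts a Paley
coclique `I ⊆ 𝔽_p` to `≈ p·|I|` point–tangent flags; over a PRIME field this is capped at the
square-root barrier `|I| ≤ √p`.  Hunter–Pohoata–Verstraëte–Zhang (2026, Prop. 2.3) observed that it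
is far more efficient to lift a square-difference-free set of INTEGERS and use only a window of the
parabola small enough that nothing wraps around modulo `p`:

* parameters `N + M² ≤ p`, a set `A ⊆ [0, N)` of naturals with `a = b + m² ⇒ a = b` on `A`;
* points `P(a,y) = (a + y² + M², y)` and tangent lines `X - 2y·Y = a + M² - y²` (`a ∈ A`, `y < M`);
* `P(a,y)` lies on the line of `(a',y')` iff `a - a' + (y - y')² ≡ 0 (mod p)`; the left side has
  absolute value `< N + M² ≤ p`, so it vanishes in `ℤ`, whence `a = a' + (y'-y)²`-type identity,
  `a = a'`, `y = y'`.

This gives `|A|·M` flags in the exact format of the stub (`ruzsa_lift`); lines through the origin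
never occur because `a + M² - y² ∈ [1, p)`.  With `M ≍ √p`, `N ≍ p` and Ruzsa-type sets
(`…ParabolaLiftSqDiffFree.lean`) it yields tangency sets of size `p^{1/2 + 0.715}` for every prime
(`…ParabolaLiftExponent.lean`), but never `c·p^{3/2}`: that would need `|A| ≫ N`, contradicting
Sárközy's theorem — the integer half of the axis is unconditional and polynomially better than every
earlier construction, and provably short of the stub.

Reference: Z. Hunter, C. Pohoata, J. Verstraëte, S. Zhang, *Large point-line matchings and small
Nikodym sets*, arXiv:2601.19879 (2026), Proposition 2.3 (bib `HunterPohoataVerstraeteZhang2026`).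
-/

set_option linter.dupNamespace false

namespace Summit.MatrixMultiplication.MatrixMultiplication.Theorems.LevelOneGL2Designs.ParabolaLift

open Finset

variable {p : ℕ} [Fact p.Prime]

/-- A natural number in `(0, p)` is non-zero in `ZMod p`. [folklore] -/
theorem natCast_ne_zero_of_pos_of_lt {n : ℕ} (h0 : 0 < n) (hn : n < p) : (n : ZMod p) ≠ 0 := by
  rw [Ne, ZMod.natCast_eq_zero_iff]
  exact Nat.not_dvd_of_pos_of_lt h0 hn

/-- An integer of absolute value `< p` that vanishes in `ZMod p` is zero. [folklore] -/
theorem int_eq_zero_of_cast_eq_zero_of_abs_lt {z : ℤ} (hz : (z : ZMod p) = 0) (hlt : |z| < p) :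
    z = 0 := by
  rw [ZMod.intCast_zmod_eq_zero_iff_dvd] at hz
  exact Int.eq_zero_of_abs_lt_dvd hz hlt

/-- **Incidence criterion of the integer parabola lift** [HPVZ2026, proof of Prop. 2.3].  For
`N + M² ≤ p`, `a, a' < N`, `y, y' < M` and `A`-membership irrelevant: the point
`(a + y² + M², y)` of `𝔽_p²` lies on the line `{v : v ⬝ᵥ c⁻¹ • (1, -2y') = 1}`,
`c = a' + M² - y'²` (the tangent at `(a' + y'² + M², y')` to the parabola `X = Y² + a' + M²`),
iff `a = a' + (y - y')²`-with-no-wraparound, i.e. iff `(a' : ℤ) = a + (y - y')²`. -/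
theorem intLift_dotProduct_eq_one_iff {N M a y a' y' : ℕ} (hNM : N + M ^ 2 ≤ p)
    (ha : a < N) (hy : y < M) (ha' : a' < N) (hy' : y' < M) :
    dotProduct ![((a + y ^ 2 + M ^ 2 : ℕ) : ZMod p), (y : ZMod p)]
        ((((a' + M ^ 2 - y' ^ 2 : ℕ) : ZMod p))⁻¹ • ![1, -2 * (y' : ZMod p)]) = 1 ↔
      (a' : ℤ) = a + ((y : ℤ) - y') ^ 2 := by
  have hyM : y ^ 2 < M ^ 2 := Nat.pow_lt_pow_left hy two_ne_zero
  have hyM' : y' ^ 2 < M ^ 2 := Nat.pow_lt_pow_left hy' two_ne_zero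
  have hc : ((a' + M ^ 2 - y' ^ 2 : ℕ) : ZMod p) ≠ 0 :=
    natCast_ne_zero_of_pos_of_lt (by omega) (by omega)
  have hcast : ((a' + M ^ 2 - y' ^ 2 : ℕ) : ZMod p) = (a' : ZMod p) + (M : ZMod p) ^ 2 - (y' : ZMod p) ^ 2 := by
    rw [Nat.cast_sub (by omega)]
    push_cast
    ring
  simp only [dotProduct, Fin.sum_univ_two, Pi.smul_apply, Matrix.cons_val_zero, Matrix.cons_val_one,
    smul_eq_mul]
  have e : ((a + y ^ 2 + M ^ 2 : ℕ) : ZMod p) * ((((a' + M ^ 2 - y' ^ 2 : ℕ) : ZMod p))⁻¹ * 1) +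
      (y : ZMod p) * ((((a' + M ^ 2 - y' ^ 2 : ℕ) : ZMod p))⁻¹ * (-2 * (y' : ZMod p)))
      = (((a' + M ^ 2 - y' ^ 2 : ℕ) : ZMod p))⁻¹ *
          (((a + y ^ 2 + M ^ 2 : ℕ) : ZMod p) - 2 * (y : ZMod p) * (y' : ZMod p)) := by ring
  rw [e, inv_mul_eq_one₀ hc, hcast]
  push_cast
  constructor
  · intro h
    -- the relation holds modulo `p` …
    have hz : (((a : ℤ) + ((y : ℤ) - y') ^ 2 - a' : ℤ) : ZMod p) = 0 := by
      push_cast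
      linear_combination -h
    -- … and the integer has absolute value `< p`, so it vanishes
    have hbound : |(a : ℤ) + ((y : ℤ) - y') ^ 2 - a'| < p := by
      have h1 : ((y : ℤ) - y') ^ 2 < (M : ℤ) ^ 2 := by
        apply sq_lt_sq' <;> omega
      have h2 : (N : ℤ) + (M : ℤ) ^ 2 ≤ p := by exact_mod_cast hNM
      rw [abs_lt]
      constructor <;> nlinarith
    have := int_eq_zero_of_cast_eq_zero_of_abs_lt hz hbound
    linarith
  · intro h
    have h' : (a' : ZMod p) = (a : ZMod p) + ((y : ZMod p) - (y' : ZMod p)) ^ 2 := by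
      have := congrArg (fun z : ℤ => (z : ZMod p)) h
      push_cast at this
      exact this
    linear_combination h'

/-- **The integer parabola lift** (Hunter–Pohoata–Verstraëte–Zhang 2026, Prop. 2.3 — "Ruzsa lift"),
in the exact format of `stub_tangencySets`.  If `N + M² ≤ p` and `A ⊆ [0,N)` has no two elements
differing by a non-zero perfect square, then the flags
`((a + y² + M², y), c⁻¹ • (1, -2y))`, `c = a + M² - y²`, over `a ∈ A`, `y < M`, form a strong
representative system of `AG(2,p)` with exactly `|A|·M` flags: `a_f ⬝ᵥ b_{f'} = 1 ↔ f = f'`.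
[cite: HunterPohoataVerstraeteZhang2026, Prop. 2.3] -/
theorem ruzsa_lift (N M : ℕ) (hNM : N + M ^ 2 ≤ p) (A : Finset ℕ) (hAN : ∀ a ∈ A, a < N)
    (hA : ∀ a ∈ A, ∀ b ∈ A, ∀ m : ℕ, a = b + m ^ 2 → a = b) :
    ∃ S : Finset ((Fin 2 → ZMod p) × (Fin 2 → ZMod p)),
      S.card = A.card * M ∧ ∀ f ∈ S, ∀ f' ∈ S, (dotProduct f.1 f'.2 = 1 ↔ f = f') := by
  classical
  set D : Finset (ℕ × ℕ) := A ×ˢ range M with hD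
  set F : ℕ × ℕ → (Fin 2 → ZMod p) × (Fin 2 → ZMod p) := fun q =>
    (![((q.1 + q.2 ^ 2 + M ^ 2 : ℕ) : ZMod p), (q.2 : ZMod p)],
      (((q.1 + M ^ 2 - q.2 ^ 2 : ℕ) : ZMod p))⁻¹ • ![1, -2 * (q.2 : ZMod p)]) with hF
  -- the incidence criterion between two flags of the family
  have key : ∀ q ∈ D, ∀ q' ∈ D, (dotProduct (F q).1 (F q').2 = 1 ↔ q = q') := by
    rintro ⟨a, y⟩ hq ⟨a', y'⟩ hq'
    simp only [hD, mem_product, mem_range] at hq hq'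
    simp only [hF]
    rw [intLift_dotProduct_eq_one_iff hNM (hAN a hq.1) hq.2 (hAN a' hq'.1) hq'.2]
    constructor
    · intro h
      -- `a' = a + m²` with `m = |y - y'|`, so `a' = a` and then `y = y'`
      obtain ⟨m, hm⟩ : ∃ m : ℕ, ((y : ℤ) - y') ^ 2 = (m : ℤ) ^ 2 :=
        ⟨((y : ℤ) - y').natAbs, (Int.natAbs_sq _).symm⟩
      rw [hm] at h
      have h1 : a' = a + m ^ 2 := by exact_mod_cast h
      have h2 : a' = a := hA a' hq'.1 a hq.1 m h1
      subst h2
      have hm0 : (m : ℤ) ^ 2 = 0 := by linarith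
      rw [← hm] at hm0
      have : (y : ℤ) = y' := by
        have := pow_eq_zero_iff (n := 2) (by norm_num) |>.mp hm0
        linarith
      have hyy : y = y' := by exact_mod_cast this
      rw [hyy]
    · intro h
      cases h
      simp
  refine ⟨D.image F, ?_, ?_⟩
  · have hinj : Set.InjOn F ↑D := by
      intro q hq q' hq' h
      have h1 : dotProduct (F q').1 (F q').2 = 1 := (key q' hq' q' hq').mpr rfl
      exact (key q hq q' hq').mp (by rw [h]; exact h1)
    rw [card_image_of_injOn hinj, hD, card_product, card_range]
  · intro f hf f' hf'
    rw [mem_image] at hf hf'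
    obtain ⟨q, hq, rfl⟩ := hf
    obtain ⟨q', hq', rfl⟩ := hf'
    rw [key q hq q' hq']
    constructor
    · intro h; rw [h]
    · intro h
      have h1 : dotProduct (F q').1 (F q').2 = 1 := (key q' hq' q' hq').mpr rfl
      exact (key q hq q' hq').mp (by rw [h]; exact h1)

end Summit.MatrixMultiplication.MatrixMultiplication.Theorems.LevelOneGL2Designs.ParabolaLift
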